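import Summits.ResolutionOfSingularities.ResolutionOfSingularities.Theses.IndSmooth
import Summits.ResolutionOfSingularities.ResolutionOfSingularities.Theorems.IndSmoothValuativeSmoothingExistsMinimal
import Summits.ResolutionOfSingularities.ResolutionOfSingularities.Theorems.IndSmoothValuativeSmoothingRefineOfNotZeroDim
import Summits.ResolutionOfSingularities.ResolutionOfSingularities.Theorems.IndSmoothValuativeSmoothingTemkinRegularChart
import Summits.ResolutionOfSingularities.ResolutionOfSingularities.Theorems.IndSmoothValuativeSmoothingSmoothNbhd
import Summits.ResolutionOfSingularities.ResolutionOfSingularities.Theorems.IndSmoothValuativeSmoothingFrobeniusDescent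
import Summits.ResolutionOfSingularities.ResolutionOfSingularities.Theorems.IndSmoothValuativeSmoothingTowerGlue
import HarnessLib

/-!
# `IndSmooth.ValuativeSmoothing` reduced to Temkin's inseparable local uniformization and ONE
# `p`-th root smoothing (crux stmt-ResolutionOfSingularities-16087, line `birth`, reshape r2)

The crux `Summit.ResolutionOfSingularities.ResolutionOfSingularities.Theses.IndSmooth.ValuativeSmoothing`
(ind-smoothness of valuation rings `O ⊇ k` of function fields `K/k`, `k` perfect of
characteristic `p`: every finitely generated `R ⊆ O` factors `R → T → O` through a smooth
`k`-algebra) is the printed open question of Antieau–Datta 2021 §4 / Elmanto–Hoyois–Iwasa–Kelly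
2020 / Tang 2024. This file records, as ONE kernel-checked implication, the reduction achieved by
line `birth` (lead reshape r2) from its six landed stubs:

`valuativeSmoothing_of_temkin2013Relative_of_pthRootSmoothing :
  Temkin2013Relative → (one p-th root smoothing for every zero-dimensional O) → ValuativeSmoothing`.

* `Temkin2013Relative` is the tree's named fact for Temkin 2013, Thm. 1.3.2 (inseparable local
  uniformization, relative form) — a published theorem whose formalization is the Literature
  unit `Temkin2013` (one open leaf).
* "One `p`-th root smoothing" for `O`: for every smooth `k`-algebra `T`, `k`-map `φ : T → K`
  landing in `O`, `g ∈ T` and `y ∈ O` with `y^p = φ(g)`, the map `T[u]/(u^p - g) → K`, `u ↦ y`,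
  factors through a smooth `k`-algebra mapping into `O`. This is the OPEN kernel: by Temkin's
  Remark 1.3.5(iii) ("local uniformization would follow from local uniformization of
  hypersurfaces `t^p = f(x₁,…,x_d)`") it carries the difficulty of local uniformization, in its
  ind-smooth (non-injective) weakening; `pthRootSmoothing_of_valuativeSmoothing` shows it is
  implied by the crux, so it has no counterexample short of one to resolution of singularities.

Mechanism (all steps landed separately under `Theorems/IndSmoothValuativeSmoothing*.lean`):
reduce to zero-dimensional `O` (`stub_existsMinimal`, `stub_refineOfNotZeroDim`); Temkin gives
`R ⊆ N ⊆ O_L`, `N` regular at the centre, `L/K` finite purely inseparable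
(`stub_temkinRegularChart`); over the perfect `k`, `N` is smooth on a basic open neighbourhood of
the centre (`stub_smoothNbhd`); with `L^{pⁿ} ⊆ K` the Frobenius image `T = Fⁿ(N) ⊆ O` is a smooth
`k`-subalgebra of `K` containing `r^{pⁿ}` for `r ∈ R` (`stub_frobeniusDescent`; were `L = K^{1/pⁿ}`
this would be local uniformization itself, Temkin Rem. 1.3.5(i)); adjoining the `pⁿ`-th roots one
`p`-th root at a time through NON-INJECTIVE smooth charts and using reducedness of smooth algebras
gives `R → T_fin → O` (`stub_towerGlue`).
-/

noncomputable section

-- single-problem summit: the doubled namespace component is forced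
set_option linter.dupNamespace false

open scoped Polynomial
open Summit.ResolutionOfSingularities.ResolutionOfSingularities.Theses.IndSmooth (ValuativeSmoothing)
open Literature.AlgebraicGeometry.Resolution (Temkin2013Relative)

namespace Summit.ResolutionOfSingularities.ResolutionOfSingularities.Theorems.ValuativeSmoothing

/-- **The crux reduced to Temkin's theorem and one `p`-th root smoothing.** If Temkin's
inseparable local uniformization (relative form, `Temkin2013Relative`) holds and, for every prime
`p`, every perfect field `k` of characteristic `p`, every finitely generated `K/k` and every
ZERO-DIMENSIONAL valuation ring `O ⊇ k` of `K` (residue field algebraic over `k`), every one-root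
datum — a smooth `k`-algebra `T`, a `k`-map `φ : T → K` into `O`, `g ∈ T`, `y ∈ O` with
`y ^ p = φ g` — factors through a smooth `k`-algebra (`ψ : T → T'`, `u ∈ T'` with `u ^ p = ψ g`,
`χ : T' → K` into `O`, `χ ∘ ψ = φ`, `χ u = y`), then `IndSmooth.ValuativeSmoothing` holds.
Composition of the six landed stubs of line `birth` (r2). [folklore] -/
theorem valuativeSmoothing_of_temkin2013Relative_of_pthRootSmoothing
    (hT : Temkin2013Relative.{0})
    (hroot : ∀ p : ℕ, p.Prime →
      ∀ (k K : Type) [Field k] [CharP k p] [PerfectField k] [Field K] [Algebra k K],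
        (⊤ : IntermediateField k K).FG → ∀ O : ValuationSubring K,
          (∀ c : k, algebraMap k K c ∈ O) →
          (∀ x ∈ O, ∃ f : k[X], f ≠ 0 ∧ Polynomial.aeval x f ∈ O.nonunits) →
          ∀ (T : Type) [CommRing T] [Algebra k T], Algebra.Smooth k T →
            ∀ φ : T →ₐ[k] K, (∀ t : T, φ t ∈ O) → ∀ (g : T) (y : K), y ∈ O → y ^ p = φ g →
              ∃ (T' : Type) (_ : CommRing T') (_ : Algebra k T'), Algebra.Smooth k T' ∧
                ∃ (ψ : T →ₐ[k] T') (u : T') (χ : T' →ₐ[k] K),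
                  (∀ t : T', χ t ∈ O) ∧ (∀ t : T, χ (ψ t) = φ t) ∧ u ^ p = ψ g ∧ χ u = y) :
    ValuativeSmoothing := by
  intro p hp k K _ _ _ _ _ hK O hO R hR hRO
  -- (1) zero-dimensional refinement `R ⊆ O₀ ≤ O`
  obtain ⟨O₀, hRO₀, hO₀O, hmin⟩ := stub_existsMinimal k K O R hRO
  have hZ : ∀ x ∈ O₀, ∃ f : k[X], f ≠ 0 ∧ Polynomial.aeval x f ∈ O₀.nonunits := by
    by_contra hZ
    obtain ⟨O'', hRO'', hle, hne⟩ := stub_refineOfNotZeroDim k K O₀ R hR hRO₀ hZ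
    exact hne (hmin O'' hRO'' hle)
  have hO₀ : ∀ c : k, algebraMap k K c ∈ O₀ := fun c => hRO₀ (R.algebraMap_mem c)
  -- (2) Temkin's regular chart, (3) smoothened over the perfect field `k`
  obtain ⟨L, iF, iA, iA', iT, hfin, hpi, O', hO', N, hN, hNfg, hRN, hreg⟩ :=
    stub_temkinRegularChart hT k K hK O₀ hO₀ R hR hRO₀
  obtain ⟨N', hN'O, hN'fg, hN's, hNN'⟩ := stub_smoothNbhd k L O' N hN hNfg hreg
  -- (4) Frobenius descent into `K`
  obtain ⟨n, T, hTO, hTs, hRT⟩ := stub_frobeniusDescent p hp k K O₀ R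
    ⟨L, iF, iA, iA', iT, hfin, hpi, O', hO', N', hN'O, hN'fg, hN's, fun r hr => hNN' (hRN r hr)⟩
  -- (5) tower glue fed with one-root smoothing for the zero-dimensional `O₀`
  obtain ⟨T₁, instT₁, instTA₁, hT₁s, ψ, χ, hχ, h⟩ :=
    stub_towerGlue p hp k K O₀ R hR hRO₀
      (fun T _ _ hTs' φ hφ g y hy hyg => hroot p hp k K hK O₀ hO₀ hZ T hTs' φ hφ g y hy hyg)
      ⟨n, T, hTO, hTs, hRT⟩
  exact ⟨T₁, instT₁, instTA₁, hT₁s, ψ, χ, fun t => hO₀O (hχ t), fun r => h r⟩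

/-- **The open kernel is necessary**: the crux implies one `p`-th root smoothing for EVERY
valuation ring `O ⊇ k` of a finitely generated `K/k` (not only zero-dimensional ones) — factor the
finitely generated subalgebra `φ(T)[y] ⊆ O` through a smooth algebra by the crux and precompose
with `T[u]/(u^p - g) → φ(T)[y]`. Hence a counterexample to the kernel is a counterexample to the
crux (and, through `UniformizingToSmooth`, to local uniformization). [folklore] -/
theorem pthRootSmoothing_of_valuativeSmoothing (hV : ValuativeSmoothing) (p : ℕ) (hp : p.Prime)
    (k K : Type) [Field k] [CharP k p] [PerfectField k] [Field K] [Algebra k K]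
    (hK : (⊤ : IntermediateField k K).FG) (O : ValuationSubring K)
    (hO : ∀ c : k, algebraMap k K c ∈ O)
    (T : Type) [CommRing T] [Algebra k T] (hTs : Algebra.Smooth k T)
    (φ : T →ₐ[k] K) (hφ : ∀ t : T, φ t ∈ O) (g : T) (y : K) (hy : y ∈ O) (hyg : y ^ p = φ g) :
    ∃ (T' : Type) (_ : CommRing T') (_ : Algebra k T'), Algebra.Smooth k T' ∧
      ∃ (ψ : T →ₐ[k] T') (u : T') (χ : T' →ₐ[k] K),
        (∀ t : T', χ t ∈ O) ∧ (∀ t : T, χ (ψ t) = φ t) ∧ u ^ p = ψ g ∧ χ u = y := by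
  classical
  haveI : Algebra.FinitePresentation k T := hTs.finitePresentation
  haveI : Algebra.FiniteType k T := inferInstance
  -- `B = φ(T)[y]`, finitely generated, inside `O`
  let B : Subalgebra k K := φ.range ⊔ Algebra.adjoin k {y}
  have hBfg : B.FG := by
    refine Subalgebra.FG.sup ?_ ⟨{y}, by rw [Finset.coe_singleton]⟩
    rw [← Algebra.map_top]
    exact (Algebra.FiniteType.out : (⊤ : Subalgebra k T).FG).map φ
  have hBO : B.toSubring ≤ O.toSubring := by
    intro x hx
    have hx' : x ∈ B := hx
    have hle : B ≤ (⟨O.toSubring.toSubsemiring, fun c => hO c⟩ : Subalgebra k K) := by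
      refine sup_le ?_ ?_
      · rintro _ ⟨t, rfl⟩
        exact hφ t
      · exact Algebra.adjoin_le (by simpa using hy)
    exact hle hx'
  obtain ⟨T', instT', instTA', hT's, ψ, χ, hχ, h⟩ := hV p hp k K hK O hO B hBfg hBO
  have hφB : ∀ t : T, φ t ∈ B := fun t => Algebra.mem_sup_left ⟨t, rfl⟩
  have hyB : y ∈ B := Algebra.mem_sup_right (Algebra.subset_adjoin rfl)
  let φB : T →ₐ[k] B := φ.codRestrict B hφB
  refine ⟨T', instT', instTA', hT's, ψ.comp φB, ψ ⟨y, hyB⟩, χ, hχ, fun t => ?_, ?_, ?_⟩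
  · rw [AlgHom.comp_apply, h]; rfl
  · rw [AlgHom.comp_apply, ← map_pow]
    congr 1
    exact Subtype.ext hyg
  · rw [h]

end Summit.ResolutionOfSingularities.ResolutionOfSingularities.Theorems.ValuativeSmoothing

end
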